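import Mathlib
import HarnessLib
import Summits.NavierStokesRegularity.NavierStokesRegularity.Theorems.PoloidalWindowDoorPoloidalWindowRigidityConstantShear
import Summits.NavierStokesRegularity.NavierStokesRegularity.Theorems.PoloidalWindowDoorPoloidalWindowRigidityProportionalShear
import Summits.NavierStokesRegularity.NavierStokesRegularity.Theorems.PoloidalWindowDoorPoloidalWindowRigidityDegenerateSlice

/-!
# Route `PoloidalWindowDoor`, crux `PoloidalWindowRigidity` (K2, stmt-NavierStokesRegularity-19708) —
# a CONSTANT CLEBSCH SLOPE ON ONE OPEN SPACE–TIME SET already settles the profile (germ form of the constant-shear stratum)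

Cell ns-regularity-ideate, seat ns-poloidal-K2-p2 (stub-worker, gen 2; support theorems `--supports` the crux,
`--as helper`).  The routine DICHOTOMY stub «stub_constSlope» of the director's restated line LRC″ (DIRECTOR-NS #21 (2)):
for a profile of the route's Type-I class (rate `C`, continuous, unit-viscosity Oseen-mild, divergence-free), poloidal
along `e₃`, the proportional-shear relation `∂₂v_b = μ ∂_bv₂` (`b = 0,1`) with ONE constant `μ` on ONE nonempty open
space–time set `U ⊆ (−∞,0) × ℝ³` propagates to EVERY slice — the defect `∂₂v_b − μ∂_bv₂` is a real-analytic function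
on the slab (joint space–time analyticity of the class, tree `…Ancient.analyticOnNhd_uncurry`, and analyticity of
Fréchet derivatives), so the identity principle on the convex slab applies — and then the constant-shear stratum
theorems end: `μ < 1` by `…ConstantShear.eq_zero_of_constantShear` (this seat, (M)-consuming), `0 < μ` by K2-p1's
kinematic `…ProportionalShear.eq_zero_of_proportionalShear`.  In the Clebsch dictionary (`v_h = ∇_hφ`, `ψ = v₂ − ∂₂φ`,
`∇_h v₂ = Λ∇_hψ`) this is `Λ = 1/(1 − μ)`: every constant `Λ ∈ ℝ ∪ {∞}` except `Λ = 0`; the remaining germ `Λ = 0`,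
i.e. `∇_h v₂ = 0` on an open space–time set, propagates the same way and ends in `…DegenerateSlice`.

* `analyticOnNhd_fderiv_slice_apply` — `(t,y) ↦ ∂_w v_b(t,y)` is real-analytic on the slab;
* `shear_of_germ` — constant proportional shear on an open space–time set ⇒ on every slice;
* `horizontalFlat_of_germ` — `∇_h v₂ = 0` on an open space–time set ⇒ on every slice;
* `eq_zero_of_constantShear_germ`, `nonflatLiouville_of_constantShear_germ` — **class + poloidal + constant proportional
  shear (any `μ : ℝ`) on a nonempty open space–time set ⇒ `v ≡ 0`** / not backward-singular;
* `eq_zero_of_horizontalFlat_germ`, `nonflatLiouville_of_horizontalFlat_germ` — the same for the germ `∇_h v₂ = 0`.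

WHAT THIS IS NOT: not a claim about Navier–Stokes regularity and not the open residue S2⁗ / LRC″ — the routine
dichotomy branch of the line (bears_on LADDER-NS N0, rung N0-LocalTubeDoorPoloidal).
-/

noncomputable section

-- the summit and its single sub-problem share the name (CONVENTIONS §1), as in every Theorems file
set_option linter.dupNamespace false

namespace Summit.NavierStokesRegularity.NavierStokesRegularity.Theorems.PoloidalWindowDoorPoloidalWindowRigidityConstantShearGerm

open Set Function Filter Topology
open scoped RealInnerProductSpace InnerProductSpace
open Literature.Analysis Literature.Analysis.FluidPDE
open Summit.NavierStokesRegularity.NavierStokesRegularity.Theorems.LocalSineTubeDoorProfileAlignedWindowRigidityAncient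
open Summit.NavierStokesRegularity.NavierStokesRegularity.Theorems.PoloidalWindowDoorPoloidalWindowRigidityFlat
open Summit.NavierStokesRegularity.NavierStokesRegularity.Theorems.PoloidalWindowDoorPoloidalWindowRigidityConstantShear
open Summit.NavierStokesRegularity.NavierStokesRegularity.Theorems.PoloidalWindowDoorPoloidalWindowRigidityProportionalShear
open Summit.NavierStokesRegularity.NavierStokesRegularity.Theorems.PoloidalWindowDoorPoloidalWindowRigidityDegenerateSlice

variable {C : ℝ} {v : ℝ → EuclideanSpace ℝ (Fin 3) → EuclideanSpace ℝ (Fin 3)}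

/-! ### Partial derivatives of the class are real-analytic in space–time -/

/-- For an Oseen-ancient field (continuous, bounded away from `t = 0`, mild), every spatial partial derivative
`(t,y) ↦ (∂_w v(t,·))(y)_b` is a real-analytic function on the slab `(−∞,0) × ℝ³`. -/
theorem analyticOnNhd_fderiv_slice_apply (hcont : ContinuousOn (uncurry v) (Iio (0 : ℝ) ×ˢ univ))
    (hbdd : ∀ δ : ℝ, 0 < δ → ∃ B : ℝ, ∀ t < -δ, ∀ y : EuclideanSpace ℝ (Fin 3), ‖v t y‖ ≤ B)
    (hmild : ∀ s t : ℝ, s < t → t < 0 → ∀ y,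
      v t y = UnboundedOperators.heatExtension (v s) (t - s) y - oseenDuhamel 1 s v v t y)
    (w : EuclideanSpace ℝ (Fin 3)) (b : Fin 3) :
    AnalyticOnNhd ℝ (fun p : ℝ × EuclideanSpace ℝ (Fin 3) => fderiv ℝ (v p.1) p.2 w b) (Iio (0 : ℝ) ×ˢ univ) := by
  have hA : AnalyticOnNhd ℝ (uncurry v) (Iio (0 : ℝ) ×ˢ univ) := analyticOnNhd_uncurry hcont hbdd hmild
  have hslab : IsOpen (Iio (0 : ℝ) ×ˢ (univ : Set (EuclideanSpace ℝ (Fin 3)))) := isOpen_Iio.prod isOpen_univ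
  have hD : AnalyticOnNhd ℝ (fderiv ℝ (uncurry v)) (Iio (0 : ℝ) ×ˢ univ) := hA.fderiv
  -- the total derivative applied to the vertical-in-time vector `(0, w)`, coordinate `b`, is analytic
  have hG : AnalyticOnNhd ℝ
      (fun p : ℝ × EuclideanSpace ℝ (Fin 3) =>
        (EuclideanSpace.proj (𝕜 := ℝ) b) ((fderiv ℝ (uncurry v) p) ((0 : ℝ), w))) (Iio (0 : ℝ) ×ˢ univ) := by
    have h1 := (ContinuousLinearMap.apply ℝ (EuclideanSpace ℝ (Fin 3)) (((0 : ℝ), w) : ℝ × EuclideanSpace ℝ (Fin 3))).comp_analyticOnNhd hD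
    exact (EuclideanSpace.proj (𝕜 := ℝ) b).comp_analyticOnNhd h1
  intro p hp
  -- near `p` the partial derivative is the total derivative restricted to `{0} × ℝ³`
  have heq : (fun q : ℝ × EuclideanSpace ℝ (Fin 3) =>
      (EuclideanSpace.proj (𝕜 := ℝ) b) ((fderiv ℝ (uncurry v) q) ((0 : ℝ), w))) =ᶠ[𝓝 p]
      (fun q : ℝ × EuclideanSpace ℝ (Fin 3) => fderiv ℝ (v q.1) q.2 w b) := by
    filter_upwards [hslab.mem_nhds hp] with q hq
    have hdq : HasFDerivAt (uncurry v) (fderiv ℝ (uncurry v) q) (q.1, q.2) :=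
      (hA q hq).differentiableAt.hasFDerivAt
    have hcomp : HasFDerivAt (fun y : EuclideanSpace ℝ (Fin 3) => uncurry v (q.1, y))
        ((fderiv ℝ (uncurry v) q).comp (ContinuousLinearMap.inr ℝ ℝ (EuclideanSpace ℝ (Fin 3)))) q.2 :=
      hdq.comp q.2 (hasFDerivAt_prodMk_right q.1 q.2)
    have hv : (fun y : EuclideanSpace ℝ (Fin 3) => uncurry v (q.1, y)) = v q.1 := by
      funext y; rfl
    rw [hv] at hcomp
    rw [hcomp.fderiv]
    simp
  exact (hG p hp).congr heq

/-- The slab `(−∞,0) × ℝ³` is preconnected (it is convex). -/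
theorem isPreconnected_slab :
    IsPreconnected (Iio (0 : ℝ) ×ˢ (univ : Set (EuclideanSpace ℝ (Fin 3)))) :=
  ((convex_Iio (0 : ℝ)).prod convex_univ).isPreconnected

/-! ### Germs propagate to every slice -/

/-- **Constant proportional shear on ONE nonempty open space–time set holds on EVERY slice** (identity principle for
the real-analytic defect `∂₂v_b − μ∂_bv₂` on the convex slab). -/
theorem shear_of_germ (hcont : ContinuousOn (uncurry v) (Iio (0 : ℝ) ×ˢ univ))
    (hbdd : ∀ δ : ℝ, 0 < δ → ∃ B : ℝ, ∀ t < -δ, ∀ y : EuclideanSpace ℝ (Fin 3), ‖v t y‖ ≤ B)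
    (hmild : ∀ s t : ℝ, s < t → t < 0 → ∀ y,
      v t y = UnboundedOperators.heatExtension (v s) (t - s) y - oseenDuhamel 1 s v v t y)
    {μ : ℝ} {U : Set (ℝ × EuclideanSpace ℝ (Fin 3))} (hU : IsOpen U) (hne : U.Nonempty)
    (hUsub : U ⊆ Iio (0 : ℝ) ×ˢ univ)
    (hgerm : ∀ p ∈ U, ∀ b : Fin 3, b ≠ 2 →
      fderiv ℝ (v p.1) p.2 (EuclideanSpace.single 2 1) b = μ * fderiv ℝ (v p.1) p.2 (EuclideanSpace.single b 1) 2) :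
    ∀ s < 0, ∀ y, ∀ b : Fin 3, b ≠ 2 →
      fderiv ℝ (v s) y (EuclideanSpace.single 2 1) b = μ * fderiv ℝ (v s) y (EuclideanSpace.single b 1) 2 := by
  intro s hs y b hb
  have hg : AnalyticOnNhd ℝ (fun p : ℝ × EuclideanSpace ℝ (Fin 3) =>
      fderiv ℝ (v p.1) p.2 (EuclideanSpace.single 2 1) b - μ * fderiv ℝ (v p.1) p.2 (EuclideanSpace.single b 1) 2)
      (Iio (0 : ℝ) ×ˢ univ) :=
    (analyticOnNhd_fderiv_slice_apply hcont hbdd hmild _ b).sub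
      (analyticOnNhd_const.mul (analyticOnNhd_fderiv_slice_apply hcont hbdd hmild _ 2))
  obtain ⟨p₀, hp₀⟩ := hne
  have hev : (fun p : ℝ × EuclideanSpace ℝ (Fin 3) =>
      fderiv ℝ (v p.1) p.2 (EuclideanSpace.single 2 1) b - μ * fderiv ℝ (v p.1) p.2 (EuclideanSpace.single b 1) 2)
      =ᶠ[𝓝 p₀] 0 := by
    filter_upwards [hU.mem_nhds hp₀] with q hq
    simp only [Pi.zero_apply, hgerm q hq b hb, sub_self]
  have hz := hg.eqOn_zero_of_preconnected_of_eventuallyEq_zero isPreconnected_slab (hUsub hp₀) hev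
    (show ((s, y) : ℝ × EuclideanSpace ℝ (Fin 3)) ∈ Iio (0 : ℝ) ×ˢ univ from mem_prod.2 ⟨hs, mem_univ _⟩)
  simpa [sub_eq_zero] using hz

/-- **`∇_h v₂ = 0` on ONE nonempty open space–time set holds on EVERY slice.** -/
theorem horizontalFlat_of_germ (hcont : ContinuousOn (uncurry v) (Iio (0 : ℝ) ×ˢ univ))
    (hbdd : ∀ δ : ℝ, 0 < δ → ∃ B : ℝ, ∀ t < -δ, ∀ y : EuclideanSpace ℝ (Fin 3), ‖v t y‖ ≤ B)
    (hmild : ∀ s t : ℝ, s < t → t < 0 → ∀ y,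
      v t y = UnboundedOperators.heatExtension (v s) (t - s) y - oseenDuhamel 1 s v v t y)
    {U : Set (ℝ × EuclideanSpace ℝ (Fin 3))} (hU : IsOpen U) (hne : U.Nonempty)
    (hUsub : U ⊆ Iio (0 : ℝ) ×ˢ univ)
    (hgerm : ∀ p ∈ U, ∀ b : Fin 3, b ≠ 2 → fderiv ℝ (v p.1) p.2 (EuclideanSpace.single b 1) 2 = 0) :
    ∀ s < 0, ∀ y, ∀ b : Fin 3, b ≠ 2 → fderiv ℝ (v s) y (EuclideanSpace.single b 1) 2 = 0 := by
  intro s hs y b hb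
  have hg := analyticOnNhd_fderiv_slice_apply hcont hbdd hmild (EuclideanSpace.single b (1 : ℝ)) 2
  obtain ⟨p₀, hp₀⟩ := hne
  have hev : (fun p : ℝ × EuclideanSpace ℝ (Fin 3) => fderiv ℝ (v p.1) p.2 (EuclideanSpace.single b 1) 2)
      =ᶠ[𝓝 p₀] 0 := by
    filter_upwards [hU.mem_nhds hp₀] with q hq
    simp only [Pi.zero_apply, hgerm q hq b hb]
  exact hg.eqOn_zero_of_preconnected_of_eventuallyEq_zero isPreconnected_slab (hUsub hp₀) hev
    (show ((s, y) : ℝ × EuclideanSpace ℝ (Fin 3)) ∈ Iio (0 : ℝ) ×ˢ univ from mem_prod.2 ⟨hs, mem_univ _⟩)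

/-! ### The germ strata are empty in the class -/

/-- **CONSTANT PROPORTIONAL SHEAR ON AN OPEN SPACE–TIME SET ⇒ TRIVIAL.**  A profile of the route's Type-I class,
poloidal along `e₃`, with `∂₂v_b = μ∂_bv₂` (`b = 0,1`) for one constant `μ : ℝ` on one nonempty open subset of the
slab, vanishes identically: the relation propagates to every slice (`shear_of_germ`), and then `μ < 1` is this seat's
(M)-consuming `eq_zero_of_constantShear`, `1 ≤ μ` (so `0 < μ`) K2-p1's kinematic `eq_zero_of_proportionalShear`. -/
theorem eq_zero_of_constantShear_germ (hrate : HasTypeITimeDecay C v)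
    (hcont : ContinuousOn (uncurry v) (Iio (0 : ℝ) ×ˢ univ))
    (hmild : ∀ s t : ℝ, s < t → t < 0 → ∀ x,
      v t x = UnboundedOperators.heatExtension (v s) (t - s) x - oseenDuhamel 1 s v v t x)
    (hdiv : ∀ t < 0, VectorCalculus.IsDivFree (v t))
    (hpol : ∀ s < 0, ∀ y, ⟪curl (v s) y, EuclideanSpace.single 2 1⟫_ℝ = 0)
    {μ : ℝ} {U : Set (ℝ × EuclideanSpace ℝ (Fin 3))} (hU : IsOpen U) (hne : U.Nonempty)
    (hUsub : U ⊆ Iio (0 : ℝ) ×ˢ univ)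
    (hgerm : ∀ p ∈ U, ∀ b : Fin 3, b ≠ 2 →
      fderiv ℝ (v p.1) p.2 (EuclideanSpace.single 2 1) b = μ * fderiv ℝ (v p.1) p.2 (EuclideanSpace.single b 1) 2) :
    ∀ t < 0, ∀ x, v t x = 0 := by
  have hslope := shear_of_germ hcont (bdd_of_hasTypeITimeDecay hrate) hmild hU hne hUsub hgerm
  rcases lt_or_ge μ 1 with hμ | hμ
  · exact eq_zero_of_constantShear hrate hcont hmild hdiv hpol hμ hslope
  · have hμ0 : 0 < μ := by linarith
    exact eq_zero_of_proportionalShear hrate hcont hmild hdiv hpol hμ0 fun s hs y =>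
      ⟨hslope s hs y 0 (by decide), hslope s hs y 1 (by decide)⟩

/-- **Constant proportional shear on an open space–time set ⇒ not backward-singular** (the stub's currency). -/
theorem nonflatLiouville_of_constantShear_germ (hrate : HasTypeITimeDecay C v)
    (hcont : ContinuousOn (uncurry v) (Iio (0 : ℝ) ×ˢ univ))
    (hmild : ∀ s t : ℝ, s < t → t < 0 → ∀ x,
      v t x = UnboundedOperators.heatExtension (v s) (t - s) x - oseenDuhamel 1 s v v t x)
    (hdiv : ∀ t < 0, VectorCalculus.IsDivFree (v t))
    (hpol : ∀ s < 0, ∀ y, ⟪curl (v s) y, EuclideanSpace.single 2 1⟫_ℝ = 0)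
    {μ : ℝ} {U : Set (ℝ × EuclideanSpace ℝ (Fin 3))} (hU : IsOpen U) (hne : U.Nonempty)
    (hUsub : U ⊆ Iio (0 : ℝ) ×ˢ univ)
    (hgerm : ∀ p ∈ U, ∀ b : Fin 3, b ≠ 2 →
      fderiv ℝ (v p.1) p.2 (EuclideanSpace.single 2 1) b = μ * fderiv ℝ (v p.1) p.2 (EuclideanSpace.single b 1) 2) :
    ¬ IsBackwardSingularPoint v 0 :=
  not_backwardSingular_of_zero (eq_zero_of_constantShear_germ hrate hcont hmild hdiv hpol hU hne hUsub hgerm)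

/-- **`∇_h v₂ = 0` ON AN OPEN SPACE–TIME SET ⇒ TRIVIAL** (the germ `Λ = 0`): the relation propagates to every slice
(`horizontalFlat_of_germ`) and `…DegenerateSlice.eq_zero_of_pointwise_degenerate_slice` ends on any one slice. -/
theorem eq_zero_of_horizontalFlat_germ (hrate : HasTypeITimeDecay C v)
    (hcont : ContinuousOn (uncurry v) (Iio (0 : ℝ) ×ˢ univ))
    (hmild : ∀ s t : ℝ, s < t → t < 0 → ∀ x,
      v t x = UnboundedOperators.heatExtension (v s) (t - s) x - oseenDuhamel 1 s v v t x)
    (hdiv : ∀ t < 0, VectorCalculus.IsDivFree (v t))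
    (hpol : ∀ s < 0, ∀ y, ⟪curl (v s) y, EuclideanSpace.single 2 1⟫_ℝ = 0)
    {U : Set (ℝ × EuclideanSpace ℝ (Fin 3))} (hU : IsOpen U) (hne : U.Nonempty)
    (hUsub : U ⊆ Iio (0 : ℝ) ×ˢ univ)
    (hgerm : ∀ p ∈ U, ∀ b : Fin 3, b ≠ 2 → fderiv ℝ (v p.1) p.2 (EuclideanSpace.single b 1) 2 = 0) :
    ∀ t < 0, ∀ x, v t x = 0 := by
  have hflat := horizontalFlat_of_germ hcont (bdd_of_hasTypeITimeDecay hrate) hmild hU hne hUsub hgerm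
  have h1 : (-1 : ℝ) < 0 := by norm_num
  exact eq_zero_of_pointwise_degenerate_slice hrate hcont hmild hdiv h1 (hpol (-1) h1) fun y =>
    Or.inr (Or.inl ⟨hflat (-1) h1 y 0 (by decide), hflat (-1) h1 y 1 (by decide)⟩)

/-- **`∇_h v₂ = 0` on an open space–time set ⇒ not backward-singular.** -/
theorem nonflatLiouville_of_horizontalFlat_germ (hrate : HasTypeITimeDecay C v)
    (hcont : ContinuousOn (uncurry v) (Iio (0 : ℝ) ×ˢ univ))
    (hmild : ∀ s t : ℝ, s < t → t < 0 → ∀ x,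
      v t x = UnboundedOperators.heatExtension (v s) (t - s) x - oseenDuhamel 1 s v v t x)
    (hdiv : ∀ t < 0, VectorCalculus.IsDivFree (v t))
    (hpol : ∀ s < 0, ∀ y, ⟪curl (v s) y, EuclideanSpace.single 2 1⟫_ℝ = 0)
    {U : Set (ℝ × EuclideanSpace ℝ (Fin 3))} (hU : IsOpen U) (hne : U.Nonempty)
    (hUsub : U ⊆ Iio (0 : ℝ) ×ˢ univ)
    (hgerm : ∀ p ∈ U, ∀ b : Fin 3, b ≠ 2 → fderiv ℝ (v p.1) p.2 (EuclideanSpace.single b 1) 2 = 0) :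
    ¬ IsBackwardSingularPoint v 0 :=
  not_backwardSingular_of_zero (eq_zero_of_horizontalFlat_germ hrate hcont hmild hdiv hpol hU hne hUsub hgerm)

end Summit.NavierStokesRegularity.NavierStokesRegularity.Theorems.PoloidalWindowDoorPoloidalWindowRigidityConstantShearGerm
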